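import Summits.ValiantsHypothesis.ValiantsHypothesis.Theorems.KPlusLogSqLawTropicalBMatchingInterlacing

/-!
# Route «KPlusLogSqLaw», crux `TropicalB` (stmt-ValiantsHypothesis-19771) — STABILITY OF THE OPTIMAL MATCHING UNDER VERTEX DELETION
# (count drops by at most one; coverage moves by at most one row and one column)

HONEST FRAMING.  Helper toward the registered stubs `stub_tropThin` / `stub_tropFat` of `Cruxes/TropicalB/Lines/birth.lean`
(crux `Summit.ValiantsHypothesis.ValiantsHypothesis.Theses.KPlusLogSqLaw.TropicalB`, item stmt-ValiantsHypothesis-19771, route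
KPlusLogSqLaw; cell `pub-symmetroid`, seat val-sym-trop-p1 g8, 2026-08-27; `--supports … --as helper`).  A COMBINATORIAL ENGINE;
nothing here bounds `TropicalB` or bears on `WeakLifting`, DoorA26 / DoorA34, `MatrixDescartes` (stmt-ValiantsHypothesis-18050) or
VP ≠ VNP.

THE POINT.  One LEVEL of the lexicographic tower of a separated dominance design (seat memo SEPARATED-LEVELS-g8.md) is, at a generic
parameter `θ`, the UNIQUE minimiser `M` of an additive weight `Σ_{e ∈ M} w e` (`w = u − θ`) over ALL matchings (any size) inside the
allowed edge set `G` of that level; the next level down lives on the vertices NOT covered by `M`.  A carry of a higher digit deletes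
vertices from `G`.  The memo's Lemmas 3–4 say what then happens to `M`, and this file proves them in the kernel, WITHOUT any
maximum / threshold machinery (hypotheses «`M` is a minimiser and the only one» are spelled out):

* `card_stable_row` / `card_stable_col` — deleting one row (column) `v` from `G`: the unique minimiser `M'` of the smaller problem has
  `|M| − 1 ≤ |M'| ≤ |M|` (the digit drops by AT MOST ONE and never increases — the interlacing law in optimiser form);
* `cover_subset_row` / `cover_subset_col` — if the digit DROPS (`|M| = |M'| + 1`) then `dom M' ⊆ dom M`, `rng M' ⊆ rng M` and `v` was
  covered by `M`: the coverage loses exactly the deleted vertex and one vertex on the other side (the two ends of the augmenting path);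
* `erase_isMin` — erasing the edge `(v, x)` of the unique minimiser gives the unique minimiser of `G` minus row `v` and column `x`;
* `cover_eq_row` / `cover_eq_col` — if the digit is UNCHANGED (`|M| = |M'|`) and `v` was covered through `(v, x) ∈ M`, then
  `rng M' = rng M` and `dom M ∖ {v} ⊆ dom M'`: the coverage trades the row `v` for one other row and keeps all columns (the even
  alternating path from `v`).
So per deleted vertex the set «vertices left for the level below» changes by at most TWO vertices — the constant in the memo's
linear law `n < 4^{K−1}·m` for pure lexicographic designs with dense supports.  Everything is derived from `MatchingExchange.exchange`
and its bookkeeping (…MatchingExchange, …MatchingInterlacing).  [folklore: Berge 1957; Murota, Discrete Convex Analysis (2003) §9]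
-/

set_option linter.dupNamespace false
set_option autoImplicit false

namespace Summit.ValiantsHypothesis.ValiantsHypothesis.Theorems.KPlusLogSqLaw

namespace MatchingExchange

open Finset
open scoped BigOperators
open Literature.Computability.MetaComplexity.PBij

variable {α β : Type*} [DecidableEq α] [DecidableEq β]

/-! ### Row deletion -/

/-- **COUNT STABILITY under ROW deletion.**  `M` the unique minimum-weight matching inside `G`, `M'` the unique minimum-weight matching
inside `G` minus row `v`: then `|M'| ≤ |M| ≤ |M'| + 1`. [folklore: M♮-concavity of the assignment valuation] -/
theorem card_stable_row {G M M' : Finset (α × β)} {v : α} {w : α × β → ℤ}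
    (hM : IsPMatching M) (hMG : M ⊆ G)
    (hmin : ∀ X : Finset (α × β), IsPMatching X → X ⊆ G → ∑ e ∈ M, w e ≤ ∑ e ∈ X, w e)
    (huniq : ∀ X : Finset (α × β), IsPMatching X → X ⊆ G → ∑ e ∈ X, w e ≤ ∑ e ∈ M, w e → X = M)
    (hM' : IsPMatching M') (hM'G : M' ⊆ G.filter (fun e => e.1 ≠ v))
    (hmin' : ∀ X : Finset (α × β), IsPMatching X → X ⊆ G.filter (fun e => e.1 ≠ v) → ∑ e ∈ M', w e ≤ ∑ e ∈ X, w e)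
    (huniq' : ∀ X : Finset (α × β), IsPMatching X → X ⊆ G.filter (fun e => e.1 ≠ v) →
      ∑ e ∈ X, w e ≤ ∑ e ∈ M', w e → X = M') :
    M'.card ≤ M.card ∧ M.card ≤ M'.card + 1 := by
  have hG' : M' ⊆ G := hM'G.trans (Finset.filter_subset _ _)
  have hvM' : v ∉ dom M' := by
    intro hv; obtain ⟨y, hy⟩ := mem_dom.1 hv
    exact (Finset.mem_filter.1 (hM'G hy)).2 rfl
  constructor
  · refine Nat.le_of_not_lt fun hlt => ?_
    obtain ⟨N₁, N₂, hN₁, hN₂, hU, hI, hc, hdom, -⟩ := exchange hM hM' hlt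
    have hUG : M ∪ M' ⊆ G := Finset.union_subset hMG hG'
    have hN₁G : N₁ ⊆ G := (subset_union_left hU).trans hUG
    have hN₂G : N₂ ⊆ G := (subset_union_right hU).trans hUG
    have hsum := wt_add_eq hU hI w
    by_cases hv : v ∈ dom M
    · have hvN₂ : v ∉ dom N₂ := row_exclusive hU hI hM hvM' (hdom hv)
      have h1 := hmin N₁ hN₁ hN₁G
      have h2 := hmin' N₂ hN₂ (subset_filter_row hN₂G hvN₂)
      have heq : N₁ = M := huniq N₁ hN₁ hN₁G (by omega)
      rw [heq] at hc
      omega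
    · have h1 := hmin' M hM (subset_filter_row hMG hv)
      have h2 := hmin M' hM' hG'
      have heq : M = M' := huniq' M hM (subset_filter_row hMG hv) h2
      rw [heq] at hlt
      exact lt_irrefl _ hlt
  · refine Nat.le_of_not_lt fun hlt => ?_
    obtain ⟨N₁, N₂, hN₁, hN₂, hU, hI, hc, -, -⟩ := exchange hM' hM (by omega)
    have hUG : M' ∪ M ⊆ G := Finset.union_subset hG' hMG
    have hN₁G : N₁ ⊆ G := (subset_union_left hU).trans hUG
    have hN₂G : N₂ ⊆ G := (subset_union_right hU).trans hUG
    have hsum := wt_add_eq hU hI w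
    have hcN := card_add_eq hU hI hc
    by_cases hv : v ∈ dom N₁
    · have hvN₂ : v ∉ dom N₂ := row_exclusive' hU hI hM hvM' hv
      have h1 := hmin N₁ hN₁ hN₁G
      have h2 := hmin' N₂ hN₂ (subset_filter_row hN₂G hvN₂)
      have heq : N₂ = M' := huniq' N₂ hN₂ (subset_filter_row hN₂G hvN₂) (by omega)
      rw [heq] at hcN
      omega
    · have h1 := hmin' N₁ hN₁ (subset_filter_row hN₁G hv)
      have h2 := hmin N₂ hN₂ hN₂G
      have heq : N₁ = M' := huniq' N₁ hN₁ (subset_filter_row hN₁G hv) (by omega)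
      rw [heq] at hc
      omega

/-- **COVERAGE NESTING when the count drops (ROW deletion).**  If `|M| = |M'| + 1` then `M'` covers only rows and columns covered by
`M`, and the deleted row `v` was covered by `M`. [folklore] -/
theorem cover_subset_row {G M M' : Finset (α × β)} {v : α} {w : α × β → ℤ}
    (hM : IsPMatching M) (hMG : M ⊆ G)
    (hmin : ∀ X : Finset (α × β), IsPMatching X → X ⊆ G → ∑ e ∈ M, w e ≤ ∑ e ∈ X, w e)
    (huniq : ∀ X : Finset (α × β), IsPMatching X → X ⊆ G → ∑ e ∈ X, w e ≤ ∑ e ∈ M, w e → X = M)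
    (hM' : IsPMatching M') (hM'G : M' ⊆ G.filter (fun e => e.1 ≠ v))
    (hmin' : ∀ X : Finset (α × β), IsPMatching X → X ⊆ G.filter (fun e => e.1 ≠ v) → ∑ e ∈ M', w e ≤ ∑ e ∈ X, w e)
    (huniq' : ∀ X : Finset (α × β), IsPMatching X → X ⊆ G.filter (fun e => e.1 ≠ v) →
      ∑ e ∈ X, w e ≤ ∑ e ∈ M', w e → X = M')
    (hcard : M.card = M'.card + 1) :
    dom M' ⊆ dom M ∧ rng M' ⊆ rng M ∧ v ∈ dom M := by
  have hG' : M' ⊆ G := hM'G.trans (Finset.filter_subset _ _)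
  have hvM' : v ∉ dom M' := by
    intro hv; obtain ⟨y, hy⟩ := mem_dom.1 hv
    exact (Finset.mem_filter.1 (hM'G hy)).2 rfl
  obtain ⟨N₁, N₂, hN₁, hN₂, hU, hI, hc, hdom, hrng⟩ := exchange hM' hM (by omega)
  have hUG : M' ∪ M ⊆ G := Finset.union_subset hG' hMG
  have hN₁G : N₁ ⊆ G := (subset_union_left hU).trans hUG
  have hN₂G : N₂ ⊆ G := (subset_union_right hU).trans hUG
  have hsum := wt_add_eq hU hI w
  by_cases hv : v ∈ dom N₁
  · have hvN₂ : v ∉ dom N₂ := row_exclusive' hU hI hM hvM' hv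
    have h1 := hmin N₁ hN₁ hN₁G
    have h2 := hmin' N₂ hN₂ (subset_filter_row hN₂G hvN₂)
    have heq : N₁ = M := huniq N₁ hN₁ hN₁G (by omega)
    rw [heq] at hdom hrng hv
    exact ⟨hdom, hrng, hv⟩
  · exfalso
    have h1 := hmin' N₁ hN₁ (subset_filter_row hN₁G hv)
    have h2 := hmin N₂ hN₂ hN₂G
    have heq : N₁ = M' := huniq' N₁ hN₁ (subset_filter_row hN₁G hv) (by omega)
    rw [heq] at hc
    omega

/-! ### Column deletion -/

/-- **COUNT STABILITY under COLUMN deletion.** [folklore] -/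
theorem card_stable_col {G M M' : Finset (α × β)} {v : β} {w : α × β → ℤ}
    (hM : IsPMatching M) (hMG : M ⊆ G)
    (hmin : ∀ X : Finset (α × β), IsPMatching X → X ⊆ G → ∑ e ∈ M, w e ≤ ∑ e ∈ X, w e)
    (huniq : ∀ X : Finset (α × β), IsPMatching X → X ⊆ G → ∑ e ∈ X, w e ≤ ∑ e ∈ M, w e → X = M)
    (hM' : IsPMatching M') (hM'G : M' ⊆ G.filter (fun e => e.2 ≠ v))
    (hmin' : ∀ X : Finset (α × β), IsPMatching X → X ⊆ G.filter (fun e => e.2 ≠ v) → ∑ e ∈ M', w e ≤ ∑ e ∈ X, w e)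
    (huniq' : ∀ X : Finset (α × β), IsPMatching X → X ⊆ G.filter (fun e => e.2 ≠ v) →
      ∑ e ∈ X, w e ≤ ∑ e ∈ M', w e → X = M') :
    M'.card ≤ M.card ∧ M.card ≤ M'.card + 1 := by
  have hG' : M' ⊆ G := hM'G.trans (Finset.filter_subset _ _)
  have hvM' : v ∉ rng M' := by
    intro hv; obtain ⟨y, hy⟩ := mem_rng.1 hv
    exact (Finset.mem_filter.1 (hM'G hy)).2 rfl
  constructor
  · refine Nat.le_of_not_lt fun hlt => ?_
    obtain ⟨N₁, N₂, hN₁, hN₂, hU, hI, hc, -, hrng⟩ := exchange hM hM' hlt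
    have hUG : M ∪ M' ⊆ G := Finset.union_subset hMG hG'
    have hN₁G : N₁ ⊆ G := (subset_union_left hU).trans hUG
    have hN₂G : N₂ ⊆ G := (subset_union_right hU).trans hUG
    have hsum := wt_add_eq hU hI w
    by_cases hv : v ∈ rng M
    · have hvN₂ : v ∉ rng N₂ := col_exclusive hU hI hM hvM' (hrng hv)
      have h1 := hmin N₁ hN₁ hN₁G
      have h2 := hmin' N₂ hN₂ (subset_filter_col hN₂G hvN₂)
      have heq : N₁ = M := huniq N₁ hN₁ hN₁G (by omega)
      rw [heq] at hc
      omega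
    · have h2 := hmin M' hM' hG'
      have heq : M = M' := huniq' M hM (subset_filter_col hMG hv) h2
      rw [heq] at hlt
      exact lt_irrefl _ hlt
  · refine Nat.le_of_not_lt fun hlt => ?_
    obtain ⟨N₁, N₂, hN₁, hN₂, hU, hI, hc, -, -⟩ := exchange hM' hM (by omega)
    have hUG : M' ∪ M ⊆ G := Finset.union_subset hG' hMG
    have hN₁G : N₁ ⊆ G := (subset_union_left hU).trans hUG
    have hN₂G : N₂ ⊆ G := (subset_union_right hU).trans hUG
    have hsum := wt_add_eq hU hI w
    have hcN := card_add_eq hU hI hc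
    by_cases hv : v ∈ rng N₁
    · have hvN₂ : v ∉ rng N₂ := col_exclusive' hU hI hM hvM' hv
      have h1 := hmin N₁ hN₁ hN₁G
      have h2 := hmin' N₂ hN₂ (subset_filter_col hN₂G hvN₂)
      have heq : N₂ = M' := huniq' N₂ hN₂ (subset_filter_col hN₂G hvN₂) (by omega)
      rw [heq] at hcN
      omega
    · have h1 := hmin' N₁ hN₁ (subset_filter_col hN₁G hv)
      have h2 := hmin N₂ hN₂ hN₂G
      have heq : N₁ = M' := huniq' N₁ hN₁ (subset_filter_col hN₁G hv) (by omega)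
      rw [heq] at hc
      omega

/-- **COVERAGE NESTING when the count drops (COLUMN deletion).** [folklore] -/
theorem cover_subset_col {G M M' : Finset (α × β)} {v : β} {w : α × β → ℤ}
    (hM : IsPMatching M) (hMG : M ⊆ G)
    (hmin : ∀ X : Finset (α × β), IsPMatching X → X ⊆ G → ∑ e ∈ M, w e ≤ ∑ e ∈ X, w e)
    (huniq : ∀ X : Finset (α × β), IsPMatching X → X ⊆ G → ∑ e ∈ X, w e ≤ ∑ e ∈ M, w e → X = M)
    (hM' : IsPMatching M') (hM'G : M' ⊆ G.filter (fun e => e.2 ≠ v))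
    (hmin' : ∀ X : Finset (α × β), IsPMatching X → X ⊆ G.filter (fun e => e.2 ≠ v) → ∑ e ∈ M', w e ≤ ∑ e ∈ X, w e)
    (huniq' : ∀ X : Finset (α × β), IsPMatching X → X ⊆ G.filter (fun e => e.2 ≠ v) →
      ∑ e ∈ X, w e ≤ ∑ e ∈ M', w e → X = M')
    (hcard : M.card = M'.card + 1) :
    dom M' ⊆ dom M ∧ rng M' ⊆ rng M ∧ v ∈ rng M := by
  have hG' : M' ⊆ G := hM'G.trans (Finset.filter_subset _ _)
  have hvM' : v ∉ rng M' := by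
    intro hv; obtain ⟨y, hy⟩ := mem_rng.1 hv
    exact (Finset.mem_filter.1 (hM'G hy)).2 rfl
  obtain ⟨N₁, N₂, hN₁, hN₂, hU, hI, hc, hdom, hrng⟩ := exchange hM' hM (by omega)
  have hUG : M' ∪ M ⊆ G := Finset.union_subset hG' hMG
  have hN₁G : N₁ ⊆ G := (subset_union_left hU).trans hUG
  have hN₂G : N₂ ⊆ G := (subset_union_right hU).trans hUG
  have hsum := wt_add_eq hU hI w
  by_cases hv : v ∈ rng N₁
  · have hvN₂ : v ∉ rng N₂ := col_exclusive' hU hI hM hvM' hv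
    have h1 := hmin N₁ hN₁ hN₁G
    have h2 := hmin' N₂ hN₂ (subset_filter_col hN₂G hvN₂)
    have heq : N₁ = M := huniq N₁ hN₁ hN₁G (by omega)
    rw [heq] at hdom hrng hv
    exact ⟨hdom, hrng, hv⟩
  · exfalso
    have h1 := hmin' N₁ hN₁ (subset_filter_col hN₁G hv)
    have h2 := hmin N₂ hN₂ hN₂G
    have heq : N₁ = M' := huniq' N₁ hN₁ (subset_filter_col hN₁G hv) (by omega)
    rw [heq] at hc
    omega

/-! ### Erasing one edge of the optimum, and the equal-count case -/

/-- **Erasing an edge of the unique minimiser** gives the unique minimiser of the problem with that edge's row AND column deleted.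
[folklore] -/
theorem erase_isMin {G M : Finset (α × β)} {v : α} {x : β} {w : α × β → ℤ}
    (hM : IsPMatching M) (hMG : M ⊆ G)
    (hmin : ∀ X : Finset (α × β), IsPMatching X → X ⊆ G → ∑ e ∈ M, w e ≤ ∑ e ∈ X, w e)
    (huniq : ∀ X : Finset (α × β), IsPMatching X → X ⊆ G → ∑ e ∈ X, w e ≤ ∑ e ∈ M, w e → X = M)
    (hvx : (v, x) ∈ M) :
    IsPMatching (M.erase (v, x)) ∧
    M.erase (v, x) ⊆ (G.filter (fun e => e.1 ≠ v)).filter (fun e => e.2 ≠ x) ∧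
    (∀ X : Finset (α × β), IsPMatching X → X ⊆ (G.filter (fun e => e.1 ≠ v)).filter (fun e => e.2 ≠ x) →
      ∑ e ∈ M.erase (v, x), w e ≤ ∑ e ∈ X, w e) ∧
    (∀ X : Finset (α × β), IsPMatching X → X ⊆ (G.filter (fun e => e.1 ≠ v)).filter (fun e => e.2 ≠ x) →
      ∑ e ∈ X, w e ≤ ∑ e ∈ M.erase (v, x), w e → X = M.erase (v, x)) := by
  have hsplit : ∑ e ∈ M, w e = ∑ e ∈ M.erase (v, x), w e + w (v, x) :=
    (Finset.sum_erase_add _ _ hvx).symm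
  -- a matching inside `G − v − x` extends by `(v, x)` to a matching inside `G`
  have hext : ∀ X : Finset (α × β), IsPMatching X → X ⊆ (G.filter (fun e => e.1 ≠ v)).filter (fun e => e.2 ≠ x) →
      IsPMatching (insert (v, x) X) ∧ insert (v, x) X ⊆ G ∧ (v, x) ∉ X := by
    intro X hX hXG
    have hvX : v ∉ dom X := by
      intro h; obtain ⟨y, hy⟩ := mem_dom.1 h
      exact (Finset.mem_filter.1 (Finset.mem_filter.1 (hXG hy)).1).2 rfl
    have hxX : x ∉ rng X := by
      intro h; obtain ⟨y, hy⟩ := mem_rng.1 h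
      exact (Finset.mem_filter.1 (hXG hy)).2 rfl
    refine ⟨hX.insert hvX hxX, ?_, fun h => hvX (mem_dom.2 ⟨x, h⟩)⟩
    intro e he
    rcases Finset.mem_insert.1 he with rfl | he
    · exact hMG hvx
    · exact (Finset.mem_filter.1 (Finset.mem_filter.1 (hXG he)).1).1
  refine ⟨hM.subset (Finset.erase_subset _ _), ?_, ?_, ?_⟩
  · intro e he
    have heM : e ∈ M := Finset.mem_of_mem_erase he
    have hne : e ≠ (v, x) := (Finset.mem_erase.1 he).1
    refine Finset.mem_filter.2 ⟨Finset.mem_filter.2 ⟨hMG heM, fun h => hne ?_⟩, fun h => hne ?_⟩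
    · obtain ⟨e1, e2⟩ := e
      simp only at h; subst h
      exact Prod.ext rfl (hM.eq_of_fst_eq heM hvx)
    · obtain ⟨e1, e2⟩ := e
      simp only at h; subst h
      exact Prod.ext (hM.eq_of_snd_eq heM hvx) rfl
  · intro X hX hXG
    obtain ⟨hX', hX'G, hnot⟩ := hext X hX hXG
    have := hmin _ hX' hX'G
    rw [Finset.sum_insert hnot, hsplit] at this
    omega
  · intro X hX hXG hle
    obtain ⟨hX', hX'G, hnot⟩ := hext X hX hXG
    have hle' : ∑ e ∈ insert (v, x) X, w e ≤ ∑ e ∈ M, w e := by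
      rw [Finset.sum_insert hnot, hsplit]; omega
    have heq := huniq _ hX' hX'G hle'
    rw [← heq, Finset.erase_insert hnot]

/-- **COVERAGE when the count is unchanged (ROW deletion).**  If `|M| = |M'|` and the deleted row `v` was covered by `M` through the
edge `(v, x)`, then `rng M' = rng M` and every row of `M` other than `v` is a row of `M'` (so `M'` covers exactly one row not covered
by `M`). [folklore] -/
theorem cover_eq_row {G M M' : Finset (α × β)} {v : α} {x : β} {w : α × β → ℤ}
    (hM : IsPMatching M) (hMG : M ⊆ G)
    (hmin : ∀ X : Finset (α × β), IsPMatching X → X ⊆ G → ∑ e ∈ M, w e ≤ ∑ e ∈ X, w e)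
    (huniq : ∀ X : Finset (α × β), IsPMatching X → X ⊆ G → ∑ e ∈ X, w e ≤ ∑ e ∈ M, w e → X = M)
    (hM' : IsPMatching M') (hM'G : M' ⊆ G.filter (fun e => e.1 ≠ v))
    (hmin' : ∀ X : Finset (α × β), IsPMatching X → X ⊆ G.filter (fun e => e.1 ≠ v) → ∑ e ∈ M', w e ≤ ∑ e ∈ X, w e)
    (huniq' : ∀ X : Finset (α × β), IsPMatching X → X ⊆ G.filter (fun e => e.1 ≠ v) →
      ∑ e ∈ X, w e ≤ ∑ e ∈ M', w e → X = M')
    (hcard : M.card = M'.card) (hvx : (v, x) ∈ M) :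
    dom (M.erase (v, x)) ⊆ dom M' ∧ rng M' = rng M := by
  obtain ⟨h0, h0G, h0min, h0uniq⟩ := erase_isMin hM hMG hmin huniq hvx
  have hc0 : M'.card = (M.erase (v, x)).card + 1 := by
    rw [Finset.card_erase_of_mem hvx, ← hcard]
    have : 0 < M.card := Finset.card_pos.2 ⟨_, hvx⟩
    omega
  -- the erased optimum is the optimum of (`G` minus row `v`) minus column `x`: apply column nesting to (`M'`, `M − (v,x)`)
  obtain ⟨hdom, hrng, hx⟩ := cover_subset_col (G := G.filter (fun e => e.1 ≠ v)) hM' hM'G hmin' huniq' h0 h0G h0min h0uniq hc0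
  refine ⟨hdom, (Finset.eq_of_subset_of_card_le (fun y hy => ?_) ?_).symm⟩
  · by_cases hyx : y = x
    · rw [hyx]; exact hx
    · obtain ⟨a, ha⟩ := mem_rng.1 hy
      have : (a, y) ∈ M.erase (v, x) := Finset.mem_erase.2 ⟨fun h => hyx (Prod.mk.inj h).2, ha⟩
      exact hrng (mem_rng.2 ⟨a, this⟩)
  · rw [hM.card_rng, hM'.card_rng, hcard]

/-- **COVERAGE when the count is unchanged (COLUMN deletion).** [folklore] -/
theorem cover_eq_col {G M M' : Finset (α × β)} {v : β} {x : α} {w : α × β → ℤ}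
    (hM : IsPMatching M) (hMG : M ⊆ G)
    (hmin : ∀ X : Finset (α × β), IsPMatching X → X ⊆ G → ∑ e ∈ M, w e ≤ ∑ e ∈ X, w e)
    (huniq : ∀ X : Finset (α × β), IsPMatching X → X ⊆ G → ∑ e ∈ X, w e ≤ ∑ e ∈ M, w e → X = M)
    (hM' : IsPMatching M') (hM'G : M' ⊆ G.filter (fun e => e.2 ≠ v))
    (hmin' : ∀ X : Finset (α × β), IsPMatching X → X ⊆ G.filter (fun e => e.2 ≠ v) → ∑ e ∈ M', w e ≤ ∑ e ∈ X, w e)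
    (huniq' : ∀ X : Finset (α × β), IsPMatching X → X ⊆ G.filter (fun e => e.2 ≠ v) →
      ∑ e ∈ X, w e ≤ ∑ e ∈ M', w e → X = M')
    (hcard : M.card = M'.card) (hxv : (x, v) ∈ M) :
    rng (M.erase (x, v)) ⊆ rng M' ∧ dom M' = dom M := by
  obtain ⟨h0, h0G, h0min, h0uniq⟩ := erase_isMin hM hMG hmin huniq hxv
  have hc0 : M'.card = (M.erase (x, v)).card + 1 := by
    rw [Finset.card_erase_of_mem hxv, ← hcard]
    have : 0 < M.card := Finset.card_pos.2 ⟨_, hxv⟩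
    omega
  -- `(G − row x) − col v = (G − col v) − row x` as edge sets
  have hcomm : (G.filter (fun e => e.1 ≠ x)).filter (fun e => e.2 ≠ v) = (G.filter (fun e => e.2 ≠ v)).filter (fun e => e.1 ≠ x) := by
    ext e; simp only [Finset.mem_filter]; tauto
  rw [hcomm] at h0G h0min h0uniq
  obtain ⟨hdom, hrng, hx⟩ := cover_subset_row (G := G.filter (fun e => e.2 ≠ v)) hM' hM'G hmin' huniq' h0 h0G h0min h0uniq hc0
  refine ⟨hrng, (Finset.eq_of_subset_of_card_le (fun y hy => ?_) ?_).symm⟩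
  · by_cases hyx : y = x
    · rw [hyx]; exact hx
    · obtain ⟨b', hb'⟩ := mem_dom.1 hy
      have : (y, b') ∈ M.erase (x, v) := Finset.mem_erase.2 ⟨fun h => hyx (Prod.mk.inj h).1, hb'⟩
      exact hdom (mem_dom.2 ⟨b', this⟩)
  · rw [hM.card_dom, hM'.card_dom, hcard]

end MatchingExchange

end Summit.ValiantsHypothesis.ValiantsHypothesis.Theorems.KPlusLogSqLaw
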